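import Summits.QuantumFields.YangMills.Theses.MarkovAtoms
import Summits.QuantumFields.YangMills.Theses.SqueezedSkewness
import Summits.QuantumFields.YangMills.Theorems.MarkovAtomsOnsetFloorMarkovTail
import Summits.QuantumFields.YangMills.Theorems.MarkovAtomsOnsetFloorUVQuietVar
import Summits.QuantumFields.YangMills.Theorems.OnsetSkewLawRPOnsetFloorCellShift
import Summits.QuantumFields.YangMills.Theorems.OnsetSkewLawRPOnsetFloorOSPigeonholeCone
import Summits.QuantumFields.YangMills.Theorems.OnsetSkewLawRPOnsetFloorCoarseCollar
import Summits.QuantumFields.YangMills.Theorems.OnsetSkewLawRPOnsetFloorAtomicCross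
import Summits.QuantumFields.YangMills.Theorems.OnsetSkewLawRPOnsetFloorFemtoAtomicFloor
import HarnessLib

/-!
# Route `MarkovAtoms`, crux `OnsetFloor` (stmt-QuantumFields-22956): CONDITIONAL BRIDGE from item 23679

`onsetFloor_of_femtoTwoPointUnit : SqueezedSkewness.FemtoTwoPointUnit → MarkovAtoms.OnsetFloor`, sorry-free — the
composition of LINE «FemtoWitness» (ym-idea-11 g14, registered skeleton on 22956) with every glue stub closed in the tree:
`RPOnsetFloorFemtoAtomic.stub_femtoAtomicFloor` (✓p700283), `RPOnsetFloorAtomicCross.stub_atomicCross` (✓p699920),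
`RPOnsetFloorCoarseCollar.coarseAtomFloor_of_crossFloorDatum` (✓p698623), `MarkovOnsetFloorUVQuietVar.stub_uvQuietVar`, `MarkovAtomsOnsetFloorMarkovTail.stub_markovTail` (✓p694555).  Consolidation
edge 23679 ⟹ 22956 (critic idea-crit-9 VERDICT #81:
PASS-WITH-PRICE, class new-combination).  Nothing is asserted: `FemtoTwoPointUnit` (XL, open) is a HYPOTHESIS; the §1
abbreviations are verbatim the skeleton's interface Props (each textually the corresponding tree statement, which is why the
by-name citations elaborate).  HONEST LABEL: conditional bridge; OnsetFloor is NOT proved outright; the YM mass gap is NOT proved.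

**v2 (weak currency).**  The main theorem now takes the WEAK TWO-POINT CURRENCY `WeakTwoPointCurrency`
(`∀ G compact simple, ∃ (r, a), 0 < a → 0 ∧ FBL ∧ (F)`) — a by-name projection of item 23679 `FemtoTwoPointUnit`, of
ym-idea-6's registered «WeakFemtoUnit» (item 23545) and of the spine's registered `CFPW` body (crux `BalabanLadder.NT`); the three
projections and the corollary from `FemtoTwoPointUnit` are included, all sorry-free.  Stub A is proved here in weak form
(`femtoAtomicFloor_weak`, verbatim w5's ✓p700283 proof fed by `(FBL, (F))`).


LANDING NOTE: authored by planner ym-idea-11 g14 (pub `ym-idea-11/g14/`, verified rc 0 / 0 sorry by idea-crit-9 ACK #80e); landed for the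
record by width seat `ym-line-sfw-p2-w4` g21 (cell ym-idea-1, free hands), verbatim except that the local `Crux` alias of the route decl is
dropped (the composition concludes the Theses decl by name directly).  [folklore]
-/

set_option autoImplicit false

noncomputable section

open scoped BigOperators
open MeasureTheory ProbabilityTheory Filter Topology Metric
open Literature.MathematicalPhysics.QuantumFieldTheory Literature.MathematicalPhysics.QuantumLattice
open Summit.QuantumFields.YangMills.Cruxes.OSLegsFromFemtoAndGap.DlrCollarTransfer (Q2 FBL FBL6 FC2 plane fbl_of_fbl6 kerCov kerK3 dens depth)
open Summit.QuantumFields.YangMills.Theorems.RPOnsetFloorFemtoAtomic (radialBump radialFn_nonneg radialFn_eq_one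
  dist_lt_of_radialFn_ne_zero tsupport_radialBump_subset b₁ centre admBump_b₁ femto_copy_eq)
open Summit.QuantumFields.YangMills.Theorems.InfiniteVolume (stateMomentStr)
open Summit.QuantumFields.YangMills.Theorems.InfVolRP (centreOffset)
open Summit.QuantumFields.YangMills.Theorems.RPOnsetFloorCellShift (AdmBump)
open Summit.QuantumFields.YangMills.Theorems.MarkovAtomsOnsetFloorMarkovTail (StubMarkovTailP)
open Summit.QuantumFields.YangMills.Theorems.MarkovOnsetFloorUVQuietVar (StubUVQuietVarP)

namespace Summit.QuantumFields.YangMills.Theorems.MarkovOnsetFloorOfFemtoTwoPointUnit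

/-! ## §1 The interface statements (obligation Props) -/

/-- ATOMIC TORUS FLOOR for the datum `(G, r)`: an admissible collar bump `(b, R₀, t)` and ONE affine image
`v = b(κ • · − w)` of it (`κ > 0`, `w₀ ≥ 0`, so `v` is positive-time) such that for `β ≥ β₅` there is a lattice
resolution `s > 0` with `κ s ≤ 1`, `κ s ≤ 2 w₀`, the collar budget `R₀ + 1 + 10 κ s ≤ 2 w₀ + t`, and the torus
two-point floor `ε ≤ Q2 G r β L s (θv) v` on all odd tori `2L+1` with `Λ₅ ≤ s L`.  (The weights `v(s•x) = b((κs)•x − w)` are then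
`b`-atoms of resolution `s_I = κ s ≤ 1`, one per orientation.) -/
abbrev AtomicTorusFloorAt (G : Type) [Group G] [TopologicalSpace G] [IsTopologicalGroup G] [CompactSpace G]
    [MeasurableSpace G] [BorelSpace G] (r : LatticeRep G) : Prop :=
  ∃ (b : SchwartzMap (EuclideanSpace ℝ (Fin 4)) ℝ) (R₀ t : ℝ), AdmBump b R₀ t ∧
    ∃ (v : SchwartzMap (EuclideanSpace ℝ (Fin 4)) ℝ) (κ : ℝ) (w : EuclideanSpace ℝ (Fin 4)),
      0 < κ ∧ 0 ≤ w 0 ∧ (∀ u : EuclideanSpace ℝ (Fin 4), v u = b (κ • u - w)) ∧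
      tsupport (v : EuclideanSpace ℝ (Fin 4) → ℝ) ⊆ {u : EuclideanSpace ℝ (Fin 4) | 0 < u 0} ∧
      ∃ (ε Λ₅ β₅ : ℝ), 0 < ε ∧ ∀ β : ℝ, β₅ ≤ β →
        ∃ s : ℝ, 0 < s ∧ κ * s ≤ 1 ∧ κ * s ≤ 2 * w 0 ∧ R₀ + 1 + 10 * (κ * s) ≤ 2 * w 0 + t ∧
          ∀ L : ℕ, Λ₅ ≤ s * L → ε ≤ Q2 G r β L s (thetaTest 4 v) v

/-- ATOMIC CROSS FLOOR for `G` (= the CONCLUSION of w5's `RPOnsetFloorCoarseCollar.CrossFloorAtomsP` v2 for this `G`,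
verbatim): a datum `r`, an admissible collar bump, `ε₀, K > 0`, `β₅`, and for `β ≥ β₅` in every odd-torus limit state
two countable `ℓ¹` families of positive-time `b`-atoms (unprimed: atoms of `A`; primed: atoms of the reflected companion
`B′`) with the cross floor `ε₀ ≤ Cov_μ((Σ' a′ F′) ∘ Θ_cfg, Σ' a F)`. -/
abbrev CrossQAt (G : Type) [Group G] [TopologicalSpace G] [IsTopologicalGroup G] [CompactSpace G]
    [MeasurableSpace G] [BorelSpace G] : Prop :=
      ∃ (r : LatticeRep G) (b : SchwartzMap (EuclideanSpace ℝ (Fin 4)) ℝ) (R₀ t ε₀ K : ℝ), AdmBump b R₀ t ∧ 0 < ε₀ ∧ 0 < K ∧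
        ∃ β₅ : ℝ, ∀ β : ℝ, β₅ ≤ β → ∀ μ ∈ oddTorusLimitPoints r β,
          ∃ s : ℝ, 0 < s ∧
          ∃ (ι : Type) (_ : Countable ι) (a : ι → ℝ) (q : ι → Fin 4 × Fin 4) (sI : ι → ℝ) (y : ι → EuclideanSpace ℝ (Fin 4))
            (ι' : Type) (_ : Countable ι') (a' : ι' → ℝ) (q' : ι' → Fin 4 × Fin 4) (sI' : ι' → ℝ)
            (y' : ι' → EuclideanSpace ℝ (Fin 4)),
            Summable (fun i => |a i|) ∧ ∑' i, |a i| ≤ K ∧ Summable (fun j => |a' j|) ∧ ∑' j, |a' j| ≤ K ∧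
            (∀ i, (q i).1 < (q i).2 ∧ s ≤ sI i ∧ -(sI i / 2) ≤ y i 0 ∧
              (sI i ≤ 1 → 0 ≤ y i 0 ∧ R₀ + 1 + 9 * sI i ≤ 2 * y i 0 + t)) ∧
            (∀ j, (q' j).1 < (q' j).2 ∧ s ≤ sI' j ∧ -(sI' j / 2) ≤ y' j 0 ∧
              (sI' j ≤ 1 → 0 ≤ y' j 0 ∧ R₀ + 1 + 9 * sI' j ≤ 2 * y' j 0 + t)) ∧
            ε₀ ≤ cov[fun U => ∑' j, a' j *
                      (∑' x : Fin 4 → ℤ, b (sI' j • (siteToE x + centreOffset (q' j)) - y' j) * plane G r (q' j) x (cfgReflect U)),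
                    fun U => ∑' i, a i *
                      (∑' x : Fin 4 → ℤ, b (sI i • (siteToE x + centreOffset (q i)) - y i) * plane G r (q i) x U); μ]

/-- COARSE COLLAR ATOM FLOOR for `G` (= the CONCLUSION of the registered stub `StubCoarseCollarP` of «FloorInheritance» v5 /
«MarkovFloorInheritance» v3 for this `G`, verbatim): for every `ε ∈ (0, ε₁]`, `β ≥ β₅(ε)` and every odd-torus limit state, ONE
coarse (`s ≤ 1`) positive-time collar atom with RP square `≥ ε`. -/
abbrev CoarseQAt (G : Type) [Group G] [TopologicalSpace G] [IsTopologicalGroup G] [CompactSpace G]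
    [MeasurableSpace G] [BorelSpace G] : Prop :=
      ∃ (r : LatticeRep G) (b : SchwartzMap (EuclideanSpace ℝ (Fin 4)) ℝ) (R₀ t ε₁ : ℝ), AdmBump b R₀ t ∧ 0 < ε₁ ∧
        ∀ ε : ℝ, 0 < ε → ε ≤ ε₁ → ∃ β₅ : ℝ, ∀ β : ℝ, β₅ ≤ β → ∀ μ ∈ oddTorusLimitPoints r β,
          let wt : Finset (Fin 4 × Fin 4) → ℝ → EuclideanSpace ℝ (Fin 4) → (Fin 4 × Fin 4) × (Fin 4 → ℤ) → ℝ := fun Q s y p => if p.1 ∈ Q ∧ p.1.1 < p.1.2 then b (s • (siteToE p.2 + centreOffset p.1) - y) else 0 ; let wr : Finset (Fin 4 × Fin 4) → ℝ → EuclideanSpace ℝ (Fin 4) → (Fin 4 × Fin 4) × (Fin 4 → ℤ) → ℝ := fun Q s y p => if p.1 ∈ Q ∧ p.1.1 < p.1.2 then b (timeReflection 4 (s • (siteToE p.2 + centreOffset p.1)) - y) else 0 ; let rpSq : Finset (Fin 4 × Fin 4) → ℝ → EuclideanSpace ℝ (Fin 4) → ℝ := fun Q s y => ∑' pp : ((Fin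 4 × Fin 4) × (Fin 4 → ℤ)) × ((Fin 4 × Fin 4) × (Fin 4 → ℤ)), wr Q s y pp.1 * wt Q s y pp.2 * stateMomentStr G r μ 2 ![pp.1.1, pp.2.1] ![pp.1.2, pp.2.2] ; ∃ s : ℝ, 0 < s ∧ s ≤ 1 ∧ ∃ (q : Fin 4 × Fin 4) (y : EuclideanSpace ℝ (Fin 4)),
            q.1 < q.2 ∧ 0 ≤ y 0 ∧ R₀ + 1 + 9 * s ≤ 2 * y 0 + t ∧ ε ≤ rpSq {q} s y

/-! ## §2 The stubs (registered obligation Props + their `stub_*` theorems) -/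

/-- STUB B statement (size M⁻): an atomic torus floor is an atomic CROSS floor in every odd-torus limit state — S1 + S2a of the
coarse-collar chain (landed: `OnsetSkewLawRPOnsetFloorOSPigeonhole.coneCrossFloor_of_torusFloor`, `smear_eq_sum_tsum_plane`) and the
single-atom expansion `v(s•x) = b(s_I•(x + o_q) − (w + s_I•o_q))`, `s_I = κ s`: 6 + 6 atoms, coefficients `1`, `K = 6`. -/
abbrev StubAtomicCrossP : Prop :=
  ∀ (G : Type) [Group G] [TopologicalSpace G] [IsTopologicalGroup G] [CompactSpace G],
    IsCompactSimpleLieGroup G → Nonempty (G ≃ₜ* Matrix.specialUnitaryGroup (Fin 2) ℂ) →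
    letI : MeasurableSpace G := borel G
    haveI : BorelSpace G := ⟨rfl⟩
    ∀ r : LatticeRep G, AtomicTorusFloorAt G r → CrossQAt G

/-- STUB C statement (CLOSED — see `stub_crossToCoarse`): an atomic cross floor gives a coarse collar atom floor — steps S3–S8
(`covariance_tsum_tsum`, `abs_cov_le_osNorm_mul`, `os_pigeonhole`, `rpSq_eq_integral_centred`, weak-coupling UV exclusion).
`CrossQAt G` is TEXTUALLY IDENTICAL to the landed `RPOnsetFloorCoarseCollar.CrossFloorDatum G` and `CoarseQAt G` to the conclusion of
the landed `RPOnsetFloorCoarseCollar.coarseAtomFloor_of_crossFloorDatum` (✓p698623, w5), which proves this stub for EVERY compact `G`. -/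
abbrev StubCrossToCoarseP : Prop :=
  ∀ (G : Type) [Group G] [TopologicalSpace G] [IsTopologicalGroup G] [CompactSpace G],
    IsCompactSimpleLieGroup G → Nonempty (G ≃ₜ* Matrix.specialUnitaryGroup (Fin 2) ℂ) →
    letI : MeasurableSpace G := borel G
    haveI : BorelSpace G := ⟨rfl⟩
    CrossQAt G → CoarseQAt G

/-- The WEAK two-point floor clause (F) at the datum `(G, r, a)` — verbatim the conclusion of the landed
`NT.WeakPackage.floor_of_fc2` / the (F)-conjunct of the spine's registered engine stub `CFPW` (crux `NT`, skeleton v3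
«weak-package») / the (F)-conjunct of ym-idea-6's registered «WeakFemtoUnit» (item 23545, LINE ν): a conditional two-point
FLOOR on x-centred femto cubes in the forward cone with growth `Γ(s)/s⁸ → ∞` and a scale-indexed collar — no upper bound,
no continuity, no `Γ ≤ 1`, one direction cone. -/
abbrev FloorF (G : Type) [Group G] [TopologicalSpace G] [IsTopologicalGroup G] [CompactSpace G]
    [MeasurableSpace G] [BorelSpace G] (r : LatticeRep G) (a : ℝ → ℝ) : Prop :=
  ∃ (Γ : ℝ → ℝ) (β₂ ℓ₂ c₂ : ℝ) (K : ℝ → ℝ) (n₀ : ℕ), 0 < ℓ₂ ∧ 0 < c₂ ∧ (∀ s, 1 ≤ K s) ∧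
    Tendsto (fun s : ℝ => s * K s) (nhdsWithin 0 (Set.Ioi 0)) (nhds 0) ∧ 1 ≤ n₀ ∧
    Tendsto (fun s : ℝ => Γ s / s ^ 8) (nhdsWithin 0 (Set.Ioi 0)) atTop ∧
    ∀ β : ℝ, β₂ ≤ β → ∀ (x : Fin 4 → ℤ) (R : ℕ), ((2 * R + 1 : ℕ) : ℝ) * a β ≤ ℓ₂ →
      ∀ (η : LGConfig 4 G) (y : Fin 4 → ℤ) (s₀ : ℝ), 0 < s₀ → s₀ ≤ ‖siteToE (y - x)‖ * a β →
        (n₀ : ℝ) ≤ ‖siteToE (y - x)‖ → ‖siteToE (y - x)‖ < 3 * siteToE (y - x) 0 →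
          K s₀ * ‖siteToE (y - x)‖ ≤ depth (fun j => x j - R) (2 * R + 1) y →
            c₂ * Γ (‖siteToE (y - x)‖ * a β) ≤
              ‖siteToE (y - x)‖ ^ 8 * kerCov G r β (fun j => x j - R) (2 * R + 1) η (dens G r x) (dens G r y)

/-- THE WEAK TWO-POINT CURRENCY «WeakTwoPointCurrency» (registered residual of the FemtoWitness skeletons) (crux-grade, XL, engine) — THE WEAKEST FEMTO CURRENCY THAT FEEDS RUNG R2a-IV's
FLOOR SIDE (lens wuc, v5): for every compact simple `G` a unit `(r, a)`, `0 < a → 0`, carrying the femto boundary law `FBL G r a`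
(density form) and the weak floor clause (F).  It is a BY-NAME PROJECTION of three filed obligations on three routes (all three
edges sorry-free below): the spine's registered `CFPW` body (`units ∧ FBL ∧ (F) ∧ (A) ∧ (T)`, crux `BalabanLadder.NT`), ym-idea-6's
registered `stub_weakFemtoUnit` (`FBL6 ∧ (F)`, item 23545), and item 23679 `SqueezedSkewness.FemtoTwoPointUnit` (`FBL6 ∧ FC2`).
Why it might fail: Bałaban-class — an exterior-uniform `C/depth⁴` boundary law and an `a`-uniform conditional femto two-point
floor for 4-D Yang–Mills in one dynamically pinned unit are not in print (engine rows N32′/N25). (sources: the Bałaban 1985–89 programme; registered-stub copy,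
not a citable fact) -/
abbrev WeakTwoPointCurrency : Prop :=
  ∀ (G : Type) [Group G] [TopologicalSpace G] [IsTopologicalGroup G] [CompactSpace G],
    IsCompactSimpleLieGroup G → letI : MeasurableSpace G := borel G; haveI : BorelSpace G := ⟨rfl⟩;
    ∃ (r : LatticeRep G) (a : ℝ → ℝ), (∀ β, 0 < a β) ∧ Tendsto a atTop (𝓝 0) ∧ FBL G r a ∧
    (∃ (Γ : ℝ → ℝ) (β₂ ℓ₂ c₂ : ℝ) (K : ℝ → ℝ) (n₀ : ℕ), 0 < ℓ₂ ∧ 0 < c₂ ∧ (∀ s, 1 ≤ K s) ∧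
    Tendsto (fun s : ℝ => s * K s) (nhdsWithin 0 (Set.Ioi 0)) (nhds 0) ∧ 1 ≤ n₀ ∧
    Tendsto (fun s : ℝ => Γ s / s ^ 8) (nhdsWithin 0 (Set.Ioi 0)) atTop ∧
    ∀ β : ℝ, β₂ ≤ β → ∀ (x : Fin 4 → ℤ) (R : ℕ), ((2 * R + 1 : ℕ) : ℝ) * a β ≤ ℓ₂ →
      ∀ (η : LGConfig 4 G) (y : Fin 4 → ℤ) (s₀ : ℝ), 0 < s₀ → s₀ ≤ ‖siteToE (y - x)‖ * a β →
        (n₀ : ℝ) ≤ ‖siteToE (y - x)‖ → ‖siteToE (y - x)‖ < 3 * siteToE (y - x) 0 →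
          K s₀ * ‖siteToE (y - x)‖ ≤ depth (fun j => x j - R) (2 * R + 1) y →
            c₂ * Γ (‖siteToE (y - x)‖ * a β) ≤
              ‖siteToE (y - x)‖ ^ 8 * kerCov G r β (fun j => x j - R) (2 * R + 1) η (dens G r x) (dens G r y))

/-- **Inbound edge 1 (sorry-free): item 23679 ⟹ the weak currency** (`fbl_of_fbl6` + `NT.WeakPackage.floor_of_fc2`). [folklore] -/
theorem weakTwoPointCurrency_of_femtoTwoPointUnit
    (hU : Summit.QuantumFields.YangMills.Theses.SqueezedSkewness.FemtoTwoPointUnit) :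
    WeakTwoPointCurrency := by
  intro G _ _ _ _ hG
  letI : MeasurableSpace G := borel G
  haveI : BorelSpace G := ⟨rfl⟩
  obtain ⟨r, a, ha, ha0, hFBL6, hFC2⟩ := hU G hG
  exact ⟨r, a, ha, ha0, fbl_of_fbl6 r a hFBL6,
    Summit.QuantumFields.YangMills.Cruxes.NT.WeakPackage.floor_of_fc2 G r a hFC2⟩

/-- **Inbound edge 2 (sorry-free): ym-idea-6's registered «WeakFemtoUnit» (item 23545, LINE ν; verbatim its text) ⟹ the weak
currency** (`fbl_of_fbl6`). [folklore] -/
theorem weakTwoPointCurrency_of_weakFemtoUnit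
    (hW : ∀ (G : Type) [Group G] [TopologicalSpace G] [IsTopologicalGroup G] [CompactSpace G],
    IsCompactSimpleLieGroup G → letI : MeasurableSpace G := borel G; haveI : BorelSpace G := ⟨rfl⟩;
    ∃ (r : LatticeRep G) (a : ℝ → ℝ), (∀ β, 0 < a β) ∧ Tendsto a atTop (𝓝 0) ∧ FBL6 G r a ∧
    (∃ (Γ : ℝ → ℝ) (β₂ ℓ₂ c₂ : ℝ) (K : ℝ → ℝ) (n₀ : ℕ), 0 < ℓ₂ ∧ 0 < c₂ ∧ (∀ s, 1 ≤ K s) ∧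
    Tendsto (fun s : ℝ => s * K s) (nhdsWithin 0 (Set.Ioi 0)) (nhds 0) ∧ 1 ≤ n₀ ∧
    Tendsto (fun s : ℝ => Γ s / s ^ 8) (nhdsWithin 0 (Set.Ioi 0)) atTop ∧
    ∀ β : ℝ, β₂ ≤ β → ∀ (x : Fin 4 → ℤ) (R : ℕ), ((2 * R + 1 : ℕ) : ℝ) * a β ≤ ℓ₂ →
      ∀ (η : LGConfig 4 G) (y : Fin 4 → ℤ) (s₀ : ℝ), 0 < s₀ → s₀ ≤ ‖siteToE (y - x)‖ * a β →
        (n₀ : ℝ) ≤ ‖siteToE (y - x)‖ → ‖siteToE (y - x)‖ < 3 * siteToE (y - x) 0 →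
          K s₀ * ‖siteToE (y - x)‖ ≤ depth (fun j => x j - R) (2 * R + 1) y →
            c₂ * Γ (‖siteToE (y - x)‖ * a β) ≤
              ‖siteToE (y - x)‖ ^ 8 * kerCov G r β (fun j => x j - R) (2 * R + 1) η (dens G r x) (dens G r y))) :
    WeakTwoPointCurrency := by
  intro G _ _ _ _ hG
  letI : MeasurableSpace G := borel G
  haveI : BorelSpace G := ⟨rfl⟩
  obtain ⟨r, a, ha, ha0, hFBL6, hF⟩ := hW G hG
  exact ⟨r, a, ha, ha0, fbl_of_fbl6 r a hFBL6, hF⟩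

/-- **Inbound edge 3 (sorry-free): the spine's registered engine stub `CFPW` (crux `BalabanLadder.NT`, skeleton v3 «weak-package»;
verbatim its body = the hypothesis of the landed `NT.WeakPackage.nt_of_weakPackage`) ⟹ the weak currency** (projection:
drop (A) and (T)). [folklore] -/
theorem weakTwoPointCurrency_of_cfpwBody
    (h : ∀ (G : Type) [Group G] [TopologicalSpace G] [IsTopologicalGroup G] [CompactSpace G],
    IsCompactSimpleLieGroup G → letI : MeasurableSpace G := borel G; haveI : BorelSpace G := ⟨rfl⟩;
    ∃ (r : LatticeRep G) (a : ℝ → ℝ), (∀ β, 0 < a β) ∧ Tendsto a atTop (𝓝 0) ∧ FBL G r a ∧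
      (∃ (Γ : ℝ → ℝ) (β₂ ℓ₂ c₂ : ℝ) (K : ℝ → ℝ) (n₀ : ℕ), 0 < ℓ₂ ∧ 0 < c₂ ∧ (∀ s, 1 ≤ K s) ∧
    Tendsto (fun s : ℝ => s * K s) (nhdsWithin 0 (Set.Ioi 0)) (nhds 0) ∧ 1 ≤ n₀ ∧
    Tendsto (fun s : ℝ => Γ s / s ^ 8) (nhdsWithin 0 (Set.Ioi 0)) atTop ∧
    ∀ β : ℝ, β₂ ≤ β → ∀ (x : Fin 4 → ℤ) (R : ℕ), ((2 * R + 1 : ℕ) : ℝ) * a β ≤ ℓ₂ →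
      ∀ (η : LGConfig 4 G) (y : Fin 4 → ℤ) (s₀ : ℝ), 0 < s₀ → s₀ ≤ ‖siteToE (y - x)‖ * a β →
        (n₀ : ℝ) ≤ ‖siteToE (y - x)‖ → ‖siteToE (y - x)‖ < 3 * siteToE (y - x) 0 →
          K s₀ * ‖siteToE (y - x)‖ ≤ depth (fun j => x j - R) (2 * R + 1) y →
            c₂ * Γ (‖siteToE (y - x)‖ * a β) ≤
              ‖siteToE (y - x)‖ ^ 8 * kerCov G r β (fun j => x j - R) (2 * R + 1) η (dens G r x) (dens G r y)) ∧
      (∃ (β₂ ℓ₂ C₂ : ℝ) (K : ℝ → ℝ) (n₀ : ℕ), 0 < ℓ₂ ∧ (∀ s, 1 ≤ K s) ∧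
        Tendsto (fun s : ℝ => s * K s) (nhdsWithin 0 (Set.Ioi 0)) (nhds 0) ∧ 1 ≤ n₀ ∧
        ∀ β : ℝ, β₂ ≤ β → ∀ (x : Fin 4 → ℤ) (R : ℕ), ((2 * R + 1 : ℕ) : ℝ) * a β ≤ ℓ₂ →
          ∀ (η : LGConfig 4 G) (u u' : Fin 4 → ℤ) (s₀ : ℝ), 0 < s₀ → s₀ ≤ ‖siteToE (u' - u)‖ * a β →
            ‖siteToE (u' - u)‖ * a β ≤ ℓ₂ → (n₀ : ℝ) ≤ ‖siteToE (u' - u)‖ →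
              K s₀ * ‖siteToE (u' - u)‖ ≤ depth (fun j => x j - R) (2 * R + 1) u →
              K s₀ * ‖siteToE (u' - u)‖ ≤ depth (fun j => x j - R) (2 * R + 1) u' →
                |‖siteToE (u' - u)‖ ^ 8 *
                    kerCov G r β (fun j => x j - R) (2 * R + 1) η (dens G r u) (dens G r u')| ≤ C₂) ∧
      (∃ (v w : EuclideanSpace ℝ (Fin 4)) (σ δ : ℝ) (Γ₃ : ℝ → ℝ) (β₃ ℓ₃ c₃ : ℝ) (K₃ : ℝ → ℝ) (n₃ : ℕ),
        (σ = 1 ∨ σ = -1) ∧ 0 < δ ∧ 2 * δ < ‖v‖ ∧ 2 * δ < ‖w‖ ∧ 2 * δ < ‖v - w‖ ∧ 0 < ℓ₃ ∧ 0 < c₃ ∧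
        (∀ s, 1 ≤ K₃ s) ∧ Tendsto (fun s : ℝ => s * K₃ s) (nhdsWithin 0 (Set.Ioi 0)) (nhds 0) ∧
        Tendsto (fun s : ℝ => Γ₃ s / s ^ 4) (nhdsWithin 0 (Set.Ioi 0)) atTop ∧
        ∀ β : ℝ, β₃ ≤ β → ∀ (x : Fin 4 → ℤ) (R : ℕ), ((2 * R + 1 : ℕ) : ℝ) * a β ≤ ℓ₃ →
          ∀ (η : LGConfig 4 G) (n : ℕ) (y z : Fin 4 → ℤ) (s₀ : ℝ), 0 < s₀ → s₀ ≤ (n : ℝ) * a β →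
            n₃ ≤ n → ‖siteToE (y - x) - (n : ℝ) • v‖ ≤ δ * n → ‖siteToE (z - x) - (n : ℝ) • w‖ ≤ δ * n →
              K₃ s₀ * n ≤ depth (fun j => x j - R) (2 * R + 1) x →
              K₃ s₀ * n ≤ depth (fun j => x j - R) (2 * R + 1) y →
              K₃ s₀ * n ≤ depth (fun j => x j - R) (2 * R + 1) z →
                c₃ * Γ₃ ((n : ℝ) * a β) ≤
                  σ * (n : ℝ) ^ 12 * kerK3 G r β (fun j => x j - R) (2 * R + 1) η x y z)) :
    WeakTwoPointCurrency := by
  intro G _ _ _ _ hG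
  letI : MeasurableSpace G := borel G
  haveI : BorelSpace G := ⟨rfl⟩
  obtain ⟨r, a, ha, ha0, hFBL, hF, -, -⟩ := h G hG
  exact ⟨r, a, ha, ha0, hFBL, hF⟩

/-- **Stub A in weak form (sorry-free, v5): `units ∧ FBL ∧ (F)` ⟹ atomic torus floor** — verbatim the proof of w5's landed
`RPOnsetFloorFemtoAtomic.femtoAtomicFloor_core` (✓p700283) with its first line fed by `(hFBL, hF)` instead of
`(fbl_of_fbl6 hFBL6, floor_of_fc2 hFC2)`; every lemma used is w5's (radial plateau bump `b₁`, `admBump_b₁`, `femto_copy_eq`). [folklore] -/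
theorem femtoAtomicFloor_weak {G : Type} [Group G] [TopologicalSpace G] [IsTopologicalGroup G] [CompactSpace G]
    [MeasurableSpace G] [BorelSpace G] (r : LatticeRep G) (a : ℝ → ℝ) (ha : ∀ β, 0 < a β)
    (ha0 : Tendsto a atTop (nhds 0)) (hFBL : FBL G r a) (hF : FloorF G r a) : AtomicTorusFloorAt G r := by
  obtain ⟨sf, ε, β₅, Λ₅, hsf, hε, H⟩ :=
    Summit.QuantumFields.YangMills.Cruxes.UVSeamRec.WeakWindow.twoPoint_floor_param_ratio_weak G r a one_pos ha ha0 hFBL hF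
  have hρ : 0 < sf / 4 := by positivity
  set p : EuclideanSpace ℝ (Fin 4) := (sf / 2) • EuclideanSpace.single (0 : Fin 4) (1 : ℝ) with hp
  set v : SchwartzMap (EuclideanSpace ℝ (Fin 4)) ℝ := radialBump p (sf / 4) hρ with hv
  have hpsingle : p = EuclideanSpace.single (0 : Fin 4) (sf / 2) := by
    rw [hp]; ext i; simp [PiLp.single_apply]
  have hv0 : ∀ z, 0 ≤ v z := fun z => radialFn_nonneg _ _ z
  have hv1 : ∀ z, dist z (EuclideanSpace.single 0 (sf / 2)) ≤ sf / 8 → v z = 1 := fun z hz =>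
    radialFn_eq_one hρ (by rw [hpsingle]; linarith)
  have hv2 : ∀ z, v z ≠ 0 → dist z (EuclideanSpace.single 0 (sf / 2)) < 2 * (sf / 8) := fun z hz => by
    have h := dist_lt_of_radialFn_ne_zero hρ hz
    rw [hpsingle] at h; linarith
  have hev : ∀ᶠ β in atTop, a β < sf / 80 := ha0.eventually (Iio_mem_nhds (by positivity))
  obtain ⟨β₆, hβ₆⟩ := Filter.eventually_atTop.1 hev
  refine ⟨b₁, 5 / 2, 3, admBump_b₁, v, 4 / sf, (2 : ℝ) • EuclideanSpace.single (0 : Fin 4) (1 : ℝ) - centre,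
    by positivity, ?_, fun u => femto_copy_eq hsf u, ?_, ε, Λ₅, max β₅ β₆, hε, fun β hβ => ?_⟩
  · simp [centre]
    norm_num
  · intro u hu
    have h := tsupport_radialBump_subset p hρ hu
    rw [mem_closedBall, dist_eq_norm] at h
    have h1 := PiLp.norm_apply_le (u - p) 0
    rw [Real.norm_eq_abs, PiLp.sub_apply] at h1
    have hp0 : p 0 = sf / 2 := by rw [hpsingle]; simp
    rw [hp0] at h1
    show 0 < u 0
    linarith [(abs_le.1 (h1.trans h)).1]
  · have hβ₅ : β₅ ≤ β := (le_max_left _ _).trans hβ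
    have haβ : a β < sf / 80 := hβ₆ β ((le_max_right _ _).trans hβ)
    have hκs : 4 / sf * a β < 1 / 20 := by
      rw [div_mul_eq_mul_div, div_lt_iff₀ hsf]; linarith
    have hw0 : ((2 : ℝ) • EuclideanSpace.single (0 : Fin 4) (1 : ℝ) - centre) 0 = 1 / 2 := by
      simp [centre]; norm_num
    refine ⟨a β, ha β, by linarith, by rw [hw0]; linarith, by rw [hw0]; linarith, fun L hL => ?_⟩
    exact H sf ⟨by rw [one_mul], le_rfl⟩ v hv0 hv1 hv2 β hβ₅ L hL

/-- STUB B — CLOSED IN THE TREE (w5, ✓p699920 `Theorems/OnsetSkewLawRPOnsetFloorAtomicCross.lean`, by name + signature):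
atomic torus floor ⇒ atomic cross floor in odd-torus limit states (S1 + S2a `coneCrossFloor_of_torusFloor` + the single-atom
expansion of `smear`/`smearR`, one atom per orientation in each family). -/
theorem stub_atomicCross : StubAtomicCrossP :=
  Summit.QuantumFields.YangMills.Theorems.RPOnsetFloorAtomicCross.stub_atomicCross

/-- STUB C — CLOSED IN THE TREE: atomic cross floor ⇒ coarse collar atom floor, by w5's landed
`RPOnsetFloorCoarseCollar.coarseAtomFloor_of_crossFloorDatum` (✓p698623; S3–S8: `ℓ¹` pair series, RP Cauchy–Schwarz, OS-seminorm
pigeonhole, weak-coupling UV exclusion). -/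
theorem stub_crossToCoarse : StubCrossToCoarseP := by
  intro G _ _ _ _ _hG _hSU
  letI : MeasurableSpace G := borel G
  haveI : BorelSpace G := ⟨rfl⟩
  intro hQ
  exact Summit.QuantumFields.YangMills.Theorems.RPOnsetFloorCoarseCollar.coarseAtomFloor_of_crossFloorDatum hQ

/-- CLOSED IN THE TREE: UV quietness in boundary-oscillation-variance currency, clause 2
(`MarkovOnsetFloorUVQuietVar.stub_uvQuietVar`). -/
theorem stub_uvQuietVar : StubUVQuietVarP :=
  Summit.QuantumFields.YangMills.Theorems.MarkovOnsetFloorUVQuietVar.stub_uvQuietVar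

/-- CLOSED IN THE TREE: the Markov tail — a coarse collar atom with RP square `≥ ε` has a cell representative with
boundary-oscillation variance `≥ |rpSq| ≥ ε` (`MarkovAtomsOnsetFloorMarkovTail.stub_markovTail`, ✓p693629/✓p694555). -/
theorem stub_markovTail : StubMarkovTailP :=
  Summit.QuantumFields.YangMills.Theorems.MarkovAtomsOnsetFloorMarkovTail.stub_markovTail

/-! ## §3 Composition (kernel-checked, no sorry of its own) -/

/-- COMPOSITION: residual + stubs A, B, C + the two closed Markov tails ⇒ the crux (the assembly of «MarkovFloorInheritance» v3
with its head replaced; `Λ₀ := 1/2`, `s₀ := 1`). -/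
theorem OnsetFloor_of (hW : WeakTwoPointCurrency)
    (hB : StubAtomicCrossP) (hC : StubCrossToCoarseP) (h₄ : StubUVQuietVarP)
    (h₆ : StubMarkovTailP) :
    Summit.QuantumFields.YangMills.Theses.MarkovAtoms.OnsetFloor := by
  intro G _ _ _ _ hG hSU
  letI : MeasurableSpace G := borel G
  haveI : BorelSpace G := ⟨rfl⟩
  obtain ⟨r₀, a, ha, ha0, hFBL, hF⟩ := hW G hG
  have hAt : AtomicTorusFloorAt G r₀ := femtoAtomicFloor_weak r₀ a ha ha0 hFBL hF
  obtain ⟨r, b, R₀, t, ε₁, hb, hε₁, hmain⟩ := hC G hG hSU (hB G hG hSU r₀ hAt)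
  refine ⟨r, b, R₀, 1 / 2, ε₁, hb.1, hb.2.1, hb.2.2.2.1, by norm_num, hε₁, fun ε hε hle => ?_⟩
  obtain ⟨β₅, hβ₅⟩ := hmain ε hε hle
  obtain ⟨β₁, hβ₁⟩ := h₄ G hG r b R₀ (1 / 2) hb.1 ε hε 1 one_pos
  refine ⟨1, max β₅ β₁, one_pos, fun β hβ μ hμ => ?_⟩
  have hA' := hβ₅ β ((le_max_left _ _).trans hβ) μ hμ
  have hB' := hβ₁ β ((le_max_right _ _).trans hβ) μ hμ
  have hT := h₆ G hG hSU r b R₀ t (1 / 2) hb (by norm_num) le_rfl β μ hμ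
  obtain ⟨s, hs0, hs1, q, y, hq, hy0, hcol, hε'⟩ := hA'
  obtain ⟨y', hy', hV⟩ := hT s hs0 hs1 q y hq hy0 hcol
  refine ⟨⟨s, hs0, q, y', hq, hy', hε'.trans ((le_abs_self _).trans hV)⟩, fun s' hs' => ?_⟩
  obtain ⟨hs0', q', y'', hq', hy'', hV'⟩ := hs'
  by_contra hgt
  have h1 : (1 : ℝ) ≤ s' := le_of_lt (lt_of_not_ge hgt)
  have := hB' s' h1 q' y'' hq' hy''
  linarith

/-- **THE BRIDGE (sorry-free): the weak two-point femto currency ⟹ `MarkovAtoms.OnsetFloor`.** [folklore] -/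
theorem onsetFloor_of_weakTwoPointCurrency (hW : WeakTwoPointCurrency) :
    Summit.QuantumFields.YangMills.Theses.MarkovAtoms.OnsetFloor :=
  OnsetFloor_of hW stub_atomicCross stub_crossToCoarse stub_uvQuietVar stub_markovTail

/-- **Corollary (sorry-free): item 23679 `SqueezedSkewness.FemtoTwoPointUnit` ⟹ `OnsetFloor`.** [folklore] -/
theorem onsetFloor_of_femtoTwoPointUnit
    (hU : Summit.QuantumFields.YangMills.Theses.SqueezedSkewness.FemtoTwoPointUnit) :
    Summit.QuantumFields.YangMills.Theses.MarkovAtoms.OnsetFloor :=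
  onsetFloor_of_weakTwoPointCurrency (weakTwoPointCurrency_of_femtoTwoPointUnit hU)

end Summit.QuantumFields.YangMills.Theorems.MarkovOnsetFloorOfFemtoTwoPointUnit

end
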